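import Summits.Ventures.PercRepro.SixThreeDischarge
import Summits.Ventures.PercRepro.SixThreeP1Compose

/-!
# C-025 at `(6, 3)` on every finite matroid — unconditional (p2, gen 6)

p5's `c025_six_three_of_tables5` derives C-025 at `(6, 3)` from the three table hypotheses on the planes with
`ρ(E ∖ G) ≤ 5` and `g ≥ 5` of a simple coloop-free core; `SixThreeDischarge.lean` proves those three hypotheses on
every such plane from p3's table rows (`SixThreeTable`, `SixThreeStep5`) through the seam identities.  The
composition is the statement of record for `C-025 (6, 3)`: `Φ(6, 3) · #U(6, 3) ≤ #Y(6, 3)` with `Φ(6, 3) = 3`.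
-/

namespace PercRepro

namespace SixThree

/-- **C-025 at `(6, 3)` on every finite matroid**: `Φ(6, 3) · #{A : ρ(A) = 6, ρ(E ∖ A) = 3} ≤ #{A : 3 < ρ(A) < 6}`. -/
theorem c025_six_three {α : Type} [DecidableEq α] (M : Matroid α) [M.Finite] :
    phiK 6 3 * ({A : Set α | A ⊆ M.E ∧ M.eRk A = ((6 : ℕ) : ℕ∞) ∧ M.eRk (M.E \ A) = ((3 : ℕ) : ℕ∞)}.ncard : ℚ) ≤
      ({A : Set α | A ⊆ M.E ∧ ((3 : ℕ) : ℕ∞) < M.eRk A ∧ M.eRk A < ((6 : ℕ) : ℕ∞)}.ncard : ℚ) :=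
  c025_six_three_of_tables5
    (fun _ _ hs _ _ _ hG _ hg5 => tableIneqAdd12_of_plane hs hG hg5)
    (fun _ _ hs _ _ _ hG _ hg5 hgen => type3_general_of_plane hs hG hg5 hgen)
    (fun _ _ hs _ _ _ hG _ hg5 L₁ L₂ h12 hnl => type3_twoLines_of_plane hs hG hg5 L₁ L₂ h12 hnl) M

end SixThree

end PercRepro
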